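import Summits.CriticalPhenomena.PercolationContinuityZ3.Theorems.FK.PressureUniquenessCriterion
import Summits.CriticalPhenomena.PercolationContinuityZ3.Theorems.FK.PressureConvexity
import HarnessLib

/-!
# FK-continuity cell, FO-10a (pressure layer): regularity of the pressure in `p` — continuous on `(0,1)` and differentiable off a
# countable set (Grimmett 2006, Thm. (4.60)(a) for `κ = log q`, with Thm. (4.63)); Thm. (4.58) convexity with its hypotheses discharged

Registered R97 (cell INBOX l.6718, 2026-08-24); registry row FO-10a-g339r; label REG-B (coordinator fk-4 g200).
Cell `fk-continuity` (bschramm), row FO-10a; support file for the FK-continuity transplant (`--supports stmt-CriticalPhenomena-4575`); builds on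
p205010 (kernel theorem, internal audit signed; external expert review pending). Pure proofs; no definitions, no named facts, no sorries; `d ≥ 1`.
UNCONDITIONAL structure; it decides nothing about FH / TP_FK / the value of `p_c(q)`.

For `q ≥ 1` and any `Φ` that is the per-site free pressure on `(0,1)` (`PressureUniquenessCriterion.lean`):
* `continuousAt_pressure` — `Φ` is continuous at every `p ∈ (0,1)` (both one-sided derivatives exist);
* **`countable_setOf_not_differentiableAt_pressure`** — `{p ∈ (0,1) : Φ not differentiable at p}` is countable (Thm. (4.60)(a): `𝒟'_κ` countable;
  here ⊆ `{p : φ⁰_{p,q} ≠ φ¹_{p,q}}` by Thm. (4.63), countable by FO-07b `countable_setOf_rcLimit_false_ne_rcLimit_true`);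
* `convexOn_pressure_logistic'` — Thm. (4.58) convexity in `π` with `hE` discharged (`LatticeEdgeCounting.lean`).
(The joint continuity in `(p,q)` and the quantitative (4.68) are `PressureContinuity.lean`.)

Honest framing: regularity of the pressure; no statement about `p_c(q)`; NOT a binder discharge, NOT `_r4`.

## References

* G. Grimmett, *The Random-Cluster Model*, Springer 2006 (`book:grimmett2006-random-cluster-model`): §4.5, Thm. (4.58), Thm. (4.60)(a), Thm. (4.63) [PDF pp. 88–93]. [Grimmett2006]
-/

noncomputable section

open Finset Filter Topology Set

namespace Summit.CriticalPhenomena.PercolationContinuityZ3.Theorems.FK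

open Literature.Probability.Percolation Literature.Probability.LatticeModels

variable {d : ℕ} {q : ℝ} {Φ : ℝ → ℝ}

/-- **The pressure is continuous on `(0,1)`**: both one-sided derivatives exist (`hasDerivWithinAt_pressure_Ioi'/Iio'`).
[cite: Grimmett2006, Thm. (4.58) (continuity of the pressure, via (4.68))] -/
theorem continuousAt_pressure (hd : 0 < d) {p : ℝ} (hp : p ∈ Set.Ioo (0 : ℝ) 1) (hq : 1 ≤ q)
    (hΦ : ∀ x ∈ Set.Ioo (0 : ℝ) 1, Tendsto (fun N : ℕ =>
      Real.log (rcPartitionFunction (finsetGraph (zdGraph d) (box d N)) x q (boxBC d false N)) / (Finset.card (box d N) : ℝ))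
        atTop (𝓝 (Φ x))) :
    ContinuousAt Φ p := by
  have he₀ : s((0 : Site d), (0 : Site d) + Pi.single ⟨0, hd⟩ 1) ∈ (zdGraph d).edgeSet := coordEdge_mem_edgeSet 0 _
  rw [continuousAt_iff_continuous_left'_right']
  exact ⟨(hasDerivWithinAt_pressure_Iio' hp hq he₀ hΦ).continuousWithinAt,
    (hasDerivWithinAt_pressure_Ioi' hp hq he₀ hΦ).continuousWithinAt⟩

/-- **Grimmett 2006, Thm. (4.60)(a) for `κ = log q`, via Thm. (4.63)**: the per-site pressure of the random-cluster model on `ℤ^d` (`d ≥ 1`,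
`q ≥ 1`) is differentiable at all but countably many `p ∈ (0,1)` — the exceptional set is `{p : φ⁰_{p,q} ≠ φ¹_{p,q}}`, countable by FO-07b.
[cite: Grimmett2006, Thm. (4.60)(a) and Thm. (4.63)] -/
theorem countable_setOf_not_differentiableAt_pressure (hd : 0 < d) (hq : 1 ≤ q)
    (hΦ : ∀ x ∈ Set.Ioo (0 : ℝ) 1, Tendsto (fun N : ℕ =>
      Real.log (rcPartitionFunction (finsetGraph (zdGraph d) (box d N)) x q (boxBC d false N)) / (Finset.card (box d N) : ℝ))
        atTop (𝓝 (Φ x))) :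
    {p : ℝ | p ∈ Set.Ioo (0 : ℝ) 1 ∧ ¬ DifferentiableAt ℝ Φ p}.Countable := by
  refine (countable_setOf_rcLimit_false_ne_rcLimit_true (d := d) hq).mono ?_
  rintro p ⟨hp, hnd⟩
  refine ⟨⟨hp.1.le, hp.2.le⟩, fun heq => hnd ?_⟩
  exact (differentiableAt_pressure_iff_rcLimit_eq' hd hp hq hΦ).2 heq

/-! ### The convexity clause with the hypotheses discharged -/

section ConvexityDischarged

variable {d : ℕ} {q : ℝ} {Φ : ℝ → ℝ}

/-- **Thm. (4.58), convexity in `π`, unconditional form**: for `q ≥ 1` and any `Φ` that is the per-site free pressure on `(0,1)`,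
`π ↦ Φ(σ(π)) − d log(1 − σ(π))` is convex on `ℝ` (`convexOn_pressure_logistic` with `hE` from `LatticeEdgeCounting`).
[cite: Grimmett2006, Thm. (4.58)] -/
theorem convexOn_pressure_logistic' (hq : 1 ≤ q)
    (hΦ : ∀ x ∈ Set.Ioo (0 : ℝ) 1, Tendsto (fun N : ℕ =>
      Real.log (rcPartitionFunction (finsetGraph (zdGraph d) (box d N)) x q (boxBC d false N)) / (Finset.card (box d N) : ℝ))
        atTop (𝓝 (Φ x))) :
    ConvexOn ℝ Set.univ (fun π : ℝ => Φ (Real.exp π / (1 + Real.exp π)) - d * Real.log (1 - Real.exp π / (1 + Real.exp π))) :=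
  convexOn_pressure_logistic (one_pos.trans_le hq) hΦ tendsto_card_edgeFinset_box_div_card_box

end ConvexityDischarged

end Summit.CriticalPhenomena.PercolationContinuityZ3.Theorems.FK
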